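import Mathlib
import HarnessLib
import Summits.HubbardSuperconductivity.HubbardSuperconductivity.Theorems.KLProgrammeC4aPPKernelTrueProductForm

/-!
# Route `KLProgramme` — crux C4a, S3 brick (B4) «(B4)-UMK1», «(M1)-NEG-PRE-KERNEL» part 1: the TRUE mixed-sign pp pair kernel at a NEGATIVE loop level —
# parity, the thermal closed form when both lines are far, and the two THERMAL SIZES of its partner derivative (near the diagonal / beyond it)

Cell `gate-hubbard-kl`, seat hubbard-kl-k3c3-p1 (g16; row «δμ-flow with klAngularMean constant piece»).  Located brick for the (U1) chain of hubbard-kl-k3c3-p3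
(g32, «(U1)-NEG-PRE»: `…C4aPreCausticLevelLineDiagonal`) / the (C)-closer lane (stub (C) `stub_twoLeg_curvature` of `KLRegimeEngineV17F2`,
stmt-HubbardSuperconductivity-20437); companion (part 2, the four kernel rows and the one-call level line) `…C4aPPKernelNegPreDiagonal`;
memo HOME/hubbard-kl-k3c3-p1/g16-M1-NEG-PRE-KERNEL.md.

WHY.  On the PRE side of a caustic window the partner line of a loop level BELOW the Fermi level, `e = −s` (`s > 0`), is the DIAGONAL `u ≈ D + s`
(`u ≥ s/2`), and the kernel is the mixed-sign pair kernel `u ↦ P(−s,u)` (`ppTrueKernel β Λ (−s) u`, the product form of `…C4aPPKernelTrueProductForm`: all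
fermionic frequencies `ωₙ = (2n+1)π/β`, above-scale Salmhofer weights `W(ωₙ,·)` at scale `Λ`).  Its plain envelope `C/max(s,u)²` is not `n`-free along the
diagonal (k3c3-p3, U1-CAUSTIC-SUP §12); what is needed is the THERMAL smallness of the mixed-sign (Pauli-blocked) bubble — a CANCELLATION ACROSS FREQUENCIES,
visible only in the closed form `P(−s,u) = [tanh(βu/2) − tanh(βs/2)]/(2(u − s))` valid when BOTH lines are far (`s, u > Λ`, `W ≡ 1`).
* §1 parity `P(−e,−u) = P(e,u)`, `∂ᵤP(−e,−u) = −∂ᵤP(e,u)` ⟹ the REFLECTED envelopes at a negative loop level: `|P(−s,u)| ≤ (12B₁+9)/max(s,|u|)` (all `u`),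
  `|∂ᵤP(−s,u)| ≤ C½/max(s,u)²` for `u ≥ s/2`, `C½ = 64B₂+120B₁+154` (`abs_ppTrueKernelDu_le_inv_max_sq` with `c = ½`);
* §2 both lines far (`Λ < |e|`, `Λ < |u|`): `N(e,u) = ½(tanh(βe/2) + tanh(βu/2))` (`Literature…tsum_matsubara_lorentzian`), `∂ᵤN = (β/4)sech²(βu/2)`, hence for
  `Λ < s`, `Λ < u`, `u ≠ s`: `∂ᵤP(−s,u) = (β/4)sech²(βu/2)/(u−s) − ½(tanh(βu/2) − tanh(βs/2))/(u−s)²` and `P(−s,u) = ½(tanh(βu/2) − tanh(βs/2))/(u−s)`;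
* §3 `f(x) = tanh(βx/2)`: `f′ = (β/2)sech²`, `f″ = −(β²/2)sech²·tanh`, an unordered mean-value tool, `sech² ≤ 4e^{−2|·|}`, `1 − tanh y ≤ 2e^{−2y}`
  (monotonicity of `tanh` and `xe^{−x} ≤ 1` are used inline);
* §4 the thermal sizes of the difference quotient: NEAR the diagonal (two mean values, intermediate point `≥ min(s,u) ≥ s/2`)
  **`abs_thermalDiagonal_deriv_le`** `≤ β²e^{−βs/2}` (`0 < s`, `u ≥ s/2`, `u ≠ s`); BEYOND it **`abs_thermalDiagonal_deriv_far_le`** `≤ 2e^{−βs}/(u−s)²` (`0 < s < u`).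
Pure real analysis on Literature objects; nothing asserts (C), K3, the window or superconductivity.
References: BGM 2006 §2.1 (2.2)–(2.5), §2.4 (2.36) [cite: BenfattoGiulianiMastropietro2006]; Salmhofer 1999 §4.2.5 (4.70)–(4.71) [cite: Salmhofer1999].
-/

noncomputable section

namespace Summit.HubbardSuperconductivity.HubbardSuperconductivity.Theorems.C4a

set_option linter.dupNamespace false -- summit = problem name (single-conjunct summit), D-0017

open Real Filter Set MeasureTheory intervalIntegral
open scoped Topology Interval
open Literature.MathematicalPhysics.QuantumLattice Literature.Analysis.SpecialFunctions

/-! ## §1 Parity of the product form and the reflected envelopes at a negative loop level -/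

/-- **`P(−e,−u) = P(e,u)`** (`W` even in the level, `eu + ω²` and the denominators even). [cite: BenfattoGiulianiMastropietro2006, §2.4 (2.36)] -/
theorem ppTrueKernel_neg_neg (β Λ e u : ℝ) : ppTrueKernel β Λ (-e) (-u) = ppTrueKernel β Λ e u := by
  unfold ppTrueKernel
  congr 1
  refine tsum_congr fun n => ?_
  rw [uvWeightFn_neg_level, uvWeightFn_neg_level, neg_sq, neg_sq, neg_mul_neg]

/-- **`∂ᵤP(−e,−u) = −∂ᵤP(e,u)`** (`W′` odd in the level). [cite: BenfattoGiulianiMastropietro2006, §2.4 (2.36)] -/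
theorem ppTrueKernelDu_neg_neg (β Λ e u : ℝ) : ppTrueKernelDu β Λ (-e) (-u) = -ppTrueKernelDu β Λ e u := by
  unfold ppTrueKernelDu
  rw [← mul_neg, ← tsum_neg]
  congr 1
  refine tsum_congr fun n => ?_
  rw [uvWeightFn_neg_level, uvWeightFn_neg_level, uvWeightFnD1_neg_level, neg_sq, neg_sq]
  ring

/-- `∂ᵤP(−s,u) = −∂ᵤP(s,−u)`: the mixed-sign kernel's partner derivative is the reflected signed one. [cite: BenfattoGiulianiMastropietro2006, §2.4 (2.36)] -/
theorem ppTrueKernelDu_negLevel_eq (β Λ s u : ℝ) : ppTrueKernelDu β Λ (-s) u = -ppTrueKernelDu β Λ s (-u) := by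
  have h := ppTrueKernelDu_neg_neg β Λ (-s) u
  rw [neg_neg] at h
  linarith

/-- **The reflected VALUE envelope**: `0 < s` ⟹ `|P(−s,u)| ≤ (12B₁+9)·(max s |u|)⁻¹` for EVERY `u`. [cite: BenfattoGiulianiMastropietro2006, §2.4 (2.36)] -/
theorem abs_ppTrueKernel_negLevel_le_inv_max {β Λ : ℝ} (hβ : 0 < β) (hΛ : 0 < Λ) {B₁ : ℝ} (hB₁ : ∀ x, |deriv salmhoferCutoff x| ≤ B₁) {s : ℝ}
    (hs : 0 < s) (u : ℝ) : |ppTrueKernel β Λ (-s) u| ≤ (12 * B₁ + 9) * (max s |u|)⁻¹ := by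
  have h := abs_ppTrueKernel_le_inv_max hβ hΛ hB₁ hs (-u)
  rw [abs_neg] at h
  have h2 : ppTrueKernel β Λ (-s) u = ppTrueKernel β Λ s (-u) := by
    rw [← ppTrueKernel_neg_neg β Λ (-s) u, neg_neg]
  rwa [h2]

/-- **The reflected DERIVATIVE envelope on the pre side's partner range**: `0 < s`, `s/2 ≤ u` ⟹ `|∂ᵤP(−s,u)| ≤ C½·(max s u)⁻¹²`, `C½ = 64B₂ + 120B₁ + 154`
(`abs_ppTrueKernelDu_le_inv_max_sq` with `c = ½` at the reflected partner `−u`). [cite: BenfattoGiulianiMastropietro2006, §2.4 (2.36)] -/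
theorem abs_ppTrueKernelDu_negLevel_le_inv_max_sq {β Λ : ℝ} (hβ : 0 < β) (hΛ : 0 < Λ) {B₁ B₂ : ℝ} (hB₁ : ∀ x, |deriv salmhoferCutoff x| ≤ B₁)
    (hB₂ : ∀ x, |deriv (deriv salmhoferCutoff) x| ≤ B₂) {s u : ℝ} (hs : 0 < s) (hu : s / 2 ≤ u) :
    |ppTrueKernelDu β Λ (-s) u| ≤ (64 * B₂ + 120 * B₁ + 154) * (max s u)⁻¹ ^ 2 := by
  have hu0 : 0 < u := by linarith
  have hsupp : 1 / 2 * s ≤ |-u| := by rw [abs_neg, abs_of_pos hu0]; linarith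
  have h := abs_ppTrueKernelDu_le_inv_max_sq hβ hΛ hB₁ hB₂ (c := 1 / 2) (by norm_num) (by norm_num) hs hsupp
  rw [abs_neg, abs_of_pos hu0] at h
  rw [ppTrueKernelDu_negLevel_eq, abs_neg]
  refine h.trans (le_of_eq ?_)
  ring

/-! ## §2 Both lines far: the closed forms at a negative loop level -/

/-- Far in absolute value: `Λ < |x| ⟹ W(ωₙ,x) = 1 ∧ W′(ωₙ,x) = 0`. [cite: Salmhofer1999, §4.2.5 (4.71)] -/
theorem uvWeightFn_ppFreq_far_abs {β Λ x : ℝ} (hΛ : 0 < Λ) (hx : Λ < |x|) (n : ℕ) :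
    uvWeightFn Λ (ppFreq β n) x = 1 ∧ uvWeightFnD1 Λ (ppFreq β n) x = 0 := by
  rcases le_or_gt 0 x with h0 | h0
  · rw [abs_of_nonneg h0] at hx
    exact uvWeightFn_ppFreq_far hΛ hx n
  · rw [abs_of_neg h0] at hx
    have h := uvWeightFn_ppFreq_far (β := β) hΛ hx n
    rwa [uvWeightFn_neg_level, uvWeightFnD1_neg_level, neg_eq_zero] at h

/-- **Both lines far ⟹ the thermal closed form of the numerator**: `Λ < |e|`, `Λ < |u|` ⟹ `N(e,u) = ½(tanh(βe/2) + tanh(βu/2))`.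
[cite: BenfattoGiulianiMastropietro2006, §2.1 (2.2)-(2.5)] -/
theorem ppTrueNumerator_far_far {β Λ e u : ℝ} (hβ : 0 < β) (hΛ : 0 < Λ) (he : Λ < |e|) (hu : Λ < |u|) :
    ppTrueNumerator β Λ e u = 1 / 2 * (Real.tanh (β * e / 2) + Real.tanh (β * u / 2)) := by
  unfold ppTrueNumerator
  have h1 : ∀ n : ℕ, uvWeightFn Λ (ppFreq β n) e * uvWeightFn Λ (ppFreq β n) u * (e / (ppFreq β n ^ 2 + e ^ 2) + u / (ppFreq β n ^ 2 + u ^ 2)) =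
      e / (ppFreq β n ^ 2 + e ^ 2) + u / (ppFreq β n ^ 2 + u ^ 2) := fun n => by
    rw [(uvWeightFn_ppFreq_far_abs (β := β) hΛ he n).1, (uvWeightFn_ppFreq_far_abs (β := β) hΛ hu n).1, one_mul, one_mul]
  rw [tsum_congr h1, (hasSum_free_ppSummand hβ e u).tsum_eq]
  field_simp
  ring

/-- **`∂ᵤN` with the partner far and the loop level far in absolute value**: `Λ < u`, `Λ < |e|` ⟹ `∂ᵤN(e,u) = (β/4)·sech²(βu/2)`.
[cite: BenfattoGiulianiMastropietro2006, §2.1 (2.2)-(2.5)] -/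
theorem ppTrueNumeratorDu_far_of_abs_far {β Λ e u : ℝ} (hβ : 0 < β) (hΛ : 0 < Λ) (hu : Λ < u) (he : Λ < |e|) :
    ppTrueNumeratorDu β Λ e u = β / 4 * sech (β * u / 2) ^ 2 := by
  rw [ppTrueNumeratorDu_of_far hΛ hu]
  have h1 : ∀ n : ℕ, uvWeightFn Λ (ppFreq β n) e * ((ppFreq β n ^ 2 - u ^ 2) / (ppFreq β n ^ 2 + u ^ 2) ^ 2) =
      (ppFreq β n ^ 2 - u ^ 2) / (ppFreq β n ^ 2 + u ^ 2) ^ 2 := fun n => by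
    rw [(uvWeightFn_ppFreq_far_abs (β := β) hΛ he n).1, one_mul]
  rw [tsum_congr h1]
  have h2 := tsum_matsubara_lorentzian_deriv hβ u
  simp only [ppFreq]
  rw [h2]
  field_simp
  ring

/-- **The mixed-sign kernel's partner derivative, both lines far, off the diagonal**: `Λ < s`, `Λ < u`, `u ≠ s` ⟹
`∂ᵤP(−s,u) = (β/4)sech²(βu/2)/(u − s) − ½(tanh(βu/2) − tanh(βs/2))/(u − s)²`. [cite: BenfattoGiulianiMastropietro2006, §2.4 (2.36)] -/
theorem ppTrueKernelDu_negLevel_far_eq {β Λ : ℝ} (hβ : 0 < β) (hΛ : 0 < Λ) {B₁ : ℝ} (hB₁ : ∀ x, |deriv salmhoferCutoff x| ≤ B₁) {s u : ℝ}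
    (hs : Λ < s) (hu : Λ < u) (hne : u ≠ s) :
    ppTrueKernelDu β Λ (-s) u =
      β / 4 * sech (β * u / 2) ^ 2 / (u - s) - 1 / 2 * (Real.tanh (β * u / 2) - Real.tanh (β * s / 2)) / (u - s) ^ 2 := by
  have hsum : -s + u ≠ 0 := fun h => hne (by linarith)
  have hsabs : Λ < |(-s)| := by rw [abs_neg, abs_of_pos (hΛ.trans hs)]; exact hs
  have huabs : Λ < |u| := by rw [abs_of_pos (hΛ.trans hu)]; exact hu
  rw [ppTrueKernelDu_eq_of_ne hβ hΛ hB₁ hsum, ppTrueNumeratorDu_far_of_abs_far hβ hΛ hu hsabs, ppTrueNumerator_far_far hβ hΛ hsabs huabs]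
  have ht : Real.tanh (β * -s / 2) = -Real.tanh (β * s / 2) := by
    rw [show β * -s / 2 = -(β * s / 2) by ring, Real.tanh_neg]
  rw [ht, show -s + u = u - s by ring]
  ring

/-- **The mixed-sign kernel's value, both lines far, off the diagonal**: `Λ < s`, `Λ < |u|`, `u ≠ s` ⟹ `P(−s,u) = ½(tanh(βu/2) − tanh(βs/2))/(u − s)`.
[cite: BenfattoGiulianiMastropietro2006, §2.4 (2.36)] -/
theorem ppTrueKernel_negLevel_far_eq {β Λ : ℝ} (hβ : 0 < β) (hΛ : 0 < Λ) {s u : ℝ} (hs : Λ < s) (hu : Λ < |u|) (hne : u ≠ s) :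
    ppTrueKernel β Λ (-s) u = 1 / 2 * (Real.tanh (β * u / 2) - Real.tanh (β * s / 2)) / (u - s) := by
  have hsum : -s + u ≠ 0 := fun h => hne (by linarith)
  have hsabs : Λ < |(-s)| := by rw [abs_neg, abs_of_pos (hΛ.trans hs)]; exact hs
  rw [ppTrueKernel_eq_div hβ Λ hsum, ppTrueNumerator_far_far hβ hΛ hsabs hu]
  have ht : Real.tanh (β * -s / 2) = -Real.tanh (β * s / 2) := by
    rw [show β * -s / 2 = -(β * s / 2) by ring, Real.tanh_neg]
  rw [ht, show -s + u = u - s by ring]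
  ring

/-! ## §3 The thermal function `f(x) = tanh(βx/2)`: two derivatives, a mean-value tool and two elementary inequalities -/

/-- `d/dx tanh(βx/2) = (β/2)·sech²(βx/2)`. [folklore] -/
theorem hasDerivAt_tanh_scaled (β x : ℝ) : HasDerivAt (fun y : ℝ => Real.tanh (β * y / 2)) (β / 2 * sech (β * x / 2) ^ 2) x := by
  have hlin : HasDerivAt (fun y : ℝ => β * y / 2) (β / 2) x := by
    have h := ((hasDerivAt_id x).const_mul β).div_const 2
    refine (h.congr_of_eventuallyEq (Eventually.of_forall fun y => ?_)).congr_deriv (by simp)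
    simp [id]
  have h := (hasDerivAt_tanh (β * x / 2)).comp x hlin
  exact h.congr_deriv (by ring)

/-- `d/dx [(β/2)·sech²(βx/2)] = −(β²/2)·sech²(βx/2)·tanh(βx/2)`. [folklore] -/
theorem hasDerivAt_sech_sq_scaled (β x : ℝ) :
    HasDerivAt (fun y : ℝ => β / 2 * sech (β * y / 2) ^ 2) (-(β ^ 2 / 2) * sech (β * x / 2) ^ 2 * Real.tanh (β * x / 2)) x := by
  have hlin : HasDerivAt (fun y : ℝ => β * y / 2) (β / 2) x := by
    have h := ((hasDerivAt_id x).const_mul β).div_const 2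
    refine (h.congr_of_eventuallyEq (Eventually.of_forall fun y => ?_)).congr_deriv (by simp)
    simp [id]
  have h1 := (hasDerivAt_sech (β * x / 2)).comp x hlin
  have h2 := (h1.pow 2).const_mul (β / 2)
  refine h2.congr_deriv ?_
  norm_num
  ring

/-- **Mean value between two distinct points, unordered**: `f b − f a = f′(c)·(b − a)` with `c` strictly between `a` and `b`. [folklore] -/
theorem exists_between_hasDerivAt_eq_slope {f f' : ℝ → ℝ} (hf : ∀ x, HasDerivAt f (f' x) x) {a b : ℝ} (hab : a ≠ b) :
    ∃ c, min a b < c ∧ c < max a b ∧ f b - f a = f' c * (b - a) := by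
  have hcont : Continuous f := continuous_iff_continuousAt.2 fun x => (hf x).continuousAt
  rcases lt_or_gt_of_ne hab with h | h
  · obtain ⟨c, hc, hc'⟩ := exists_hasDerivAt_eq_slope f f' h hcont.continuousOn (fun x _ => hf x)
    refine ⟨c, by rw [min_eq_left h.le]; exact hc.1, by rw [max_eq_right h.le]; exact hc.2, ?_⟩
    rw [hc']
    field_simp [sub_ne_zero.2 hab.symm]
  · obtain ⟨c, hc, hc'⟩ := exists_hasDerivAt_eq_slope f f' h hcont.continuousOn (fun x _ => hf x)
    refine ⟨c, by rw [min_eq_right h.le]; exact hc.1, by rw [max_eq_left h.le]; exact hc.2, ?_⟩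
    rw [hc']
    field_simp [sub_ne_zero.2 hab]
    ring

/-- `sech² y ≤ 4·e^{−2|y|}`. [folklore] -/
theorem sech_sq_le_four_exp_neg (y : ℝ) : sech y ^ 2 ≤ 4 * Real.exp (-(2 * |y|)) := by
  have hs := sech_le_two_mul_exp_neg_abs y
  have hs0 := (sech_pos y).le
  have hexp : Real.exp (-|y|) ^ 2 = Real.exp (-(2 * |y|)) := by
    rw [← Real.exp_nat_mul]; congr 1; push_cast; ring
  calc sech y ^ 2 ≤ (2 * Real.exp (-|y|)) ^ 2 := pow_le_pow_left₀ hs0 hs 2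
    _ = 4 * Real.exp (-(2 * |y|)) := by rw [mul_pow, hexp]; norm_num

/-- `1 − tanh y ≤ 2·e^{−2y}` (all real `y`). [folklore] -/
theorem one_sub_tanh_le_two_exp_neg (y : ℝ) : 1 - Real.tanh y ≤ 2 * Real.exp (-(2 * y)) := by
  rw [Real.tanh_eq]
  have h1 : 0 < Real.exp y := Real.exp_pos y
  have h2 : 0 < Real.exp (-y) := Real.exp_pos _
  have h4 : Real.exp (-y) * Real.exp y = 1 := by rw [← Real.exp_add]; simp
  have h3 : Real.exp (-(2 * y)) = Real.exp (-y) * Real.exp (-y) := by rw [← Real.exp_add]; ring_nf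
  have key : 1 - (Real.exp y - Real.exp (-y)) / (Real.exp y + Real.exp (-y)) = 2 * Real.exp (-y) / (Real.exp y + Real.exp (-y)) := by
    field_simp
    ring
  rw [key, h3, div_le_iff₀ (by positivity)]
  nlinarith [mul_pos (mul_pos h2 h2) h2]

/-! ## §4 The thermal sizes of the mixed-sign difference quotient -/

/-- **NEAR THE DIAGONAL (two mean values)**: `0 < s`, `s/2 ≤ u`, `u ≠ s` ⟹
`|(β/4)sech²(βu/2)/(u − s) − ½(tanh(βu/2) − tanh(βs/2))/(u − s)²| ≤ β²·e^{−βs/2}`: the expression is `½(f′(u) − f′(η))/(u − s) = ½f″(ζ)(u − η)/(u − s)`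
with `η, ζ` between `s` and `u` (so `ζ ≥ s/2`), and `|f″| ≤ (β²/2)sech² ≤ 2β²e^{−β·}`. [cite: BenfattoGiulianiMastropietro2006, §2.1 (2.2)-(2.5)] -/
theorem abs_thermalDiagonal_deriv_le {β s u : ℝ} (hβ : 0 < β) (hs : 0 < s) (hu : s / 2 ≤ u) (hne : u ≠ s) :
    |β / 4 * sech (β * u / 2) ^ 2 / (u - s) - 1 / 2 * (Real.tanh (β * u / 2) - Real.tanh (β * s / 2)) / (u - s) ^ 2| ≤
      β ^ 2 * Real.exp (-(β / 2 * s)) := by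
  set f' : ℝ → ℝ := fun y => β / 2 * sech (β * y / 2) ^ 2 with hf'
  set f'' : ℝ → ℝ := fun y => -(β ^ 2 / 2) * sech (β * y / 2) ^ 2 * Real.tanh (β * y / 2) with hf''
  have hd1 : ∀ y, HasDerivAt (fun y : ℝ => Real.tanh (β * y / 2)) (f' y) y := fun y => hasDerivAt_tanh_scaled β y
  have hd2 : ∀ y, HasDerivAt f' (f'' y) y := fun y => hasDerivAt_sech_sq_scaled β y
  have hus : u - s ≠ 0 := sub_ne_zero.2 hne
  -- first mean value: `f u − f s = f′(η)(u − s)`, `η` between `s` and `u`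
  obtain ⟨η, hη1, hη2, hη⟩ := exists_between_hasDerivAt_eq_slope hd1 hne.symm
  have hexpr : β / 4 * sech (β * u / 2) ^ 2 / (u - s) - 1 / 2 * (Real.tanh (β * u / 2) - Real.tanh (β * s / 2)) / (u - s) ^ 2 =
      1 / 2 * (f' u - f' η) / (u - s) := by
    rw [hη]
    simp only [hf']
    field_simp
    ring
  -- `η ≠ u`
  have hηu : η ≠ u := by
    intro h
    rw [h] at hη1 hη2
    rcases lt_or_gt_of_ne hne with h' | h'
    · rw [min_eq_right h'.le] at hη1; exact lt_irrefl _ hη1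
    · rw [max_eq_right h'.le] at hη2; exact lt_irrefl _ hη2
  -- second mean value: `f′ u − f′ η = f″(ζ)(u − η)`, `ζ` between `η` and `u`
  obtain ⟨ζ, hζ1, _hζ2, hζ⟩ := exists_between_hasDerivAt_eq_slope hd2 hηu
  rw [hexpr, hζ]
  have hratio : |u - η| ≤ |u - s| := by
    rcases lt_or_gt_of_ne hne with h' | h'
    · rw [min_eq_right h'.le] at hη1
      rw [max_eq_left h'.le] at hη2
      rw [abs_of_neg (by linarith), abs_of_neg (by linarith)]
      linarith
    · rw [min_eq_left h'.le] at hη1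
      rw [max_eq_right h'.le] at hη2
      rw [abs_of_pos (by linarith), abs_of_pos (by linarith)]
      linarith
  -- `ζ ≥ s/2`
  have hζpos : s / 2 ≤ ζ := by
    have hmin : s / 2 ≤ min s u := le_min (by linarith) hu
    have hη0 : s / 2 ≤ η := by linarith [hmin]
    have hmin' : s / 2 ≤ min η u := le_min hη0 hu
    linarith [hmin']
  -- `|f″(ζ)| ≤ 2β²e^{−βs/2}`
  have hf''le : |f'' ζ| ≤ 2 * β ^ 2 * Real.exp (-(β / 2 * s)) := by
    simp only [hf'']
    have hζ0 : 0 ≤ ζ := by linarith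
    have hsech : sech (β * ζ / 2) ^ 2 ≤ 4 * Real.exp (-(2 * |β * ζ / 2|)) := sech_sq_le_four_exp_neg _
    have habs : 2 * |β * ζ / 2| = β * ζ := by rw [abs_of_nonneg (by positivity)]; ring
    rw [habs] at hsech
    have hexp : Real.exp (-(β * ζ)) ≤ Real.exp (-(β / 2 * s)) := Real.exp_le_exp.2 (by nlinarith)
    have htanh : |Real.tanh (β * ζ / 2)| ≤ 1 := by rw [abs_le]; exact ⟨(Real.neg_one_lt_tanh _).le, (Real.tanh_lt_one _).le⟩
    rw [abs_mul, abs_mul, abs_neg, abs_of_pos (by positivity : (0 : ℝ) < β ^ 2 / 2), abs_of_nonneg (by positivity : (0 : ℝ) ≤ sech (β * ζ / 2) ^ 2)]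
    have hsech' : sech (β * ζ / 2) ^ 2 ≤ 4 * Real.exp (-(β / 2 * s)) := hsech.trans (by linarith)
    calc β ^ 2 / 2 * sech (β * ζ / 2) ^ 2 * |Real.tanh (β * ζ / 2)| ≤ β ^ 2 / 2 * (4 * Real.exp (-(β / 2 * s))) * 1 :=
          mul_le_mul (mul_le_mul_of_nonneg_left hsech' (by positivity)) htanh (abs_nonneg _) (by positivity)
      _ = 2 * β ^ 2 * Real.exp (-(β / 2 * s)) := by ring
  have hus' : 0 < |u - s| := abs_pos.2 hus
  rw [abs_div, abs_mul, abs_mul, abs_of_pos (by norm_num : (0 : ℝ) < 1 / 2)]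
  calc 1 / 2 * (|f'' ζ| * |u - η|) / |u - s| ≤ 1 / 2 * (|f'' ζ| * |u - s|) / |u - s| := by gcongr
    _ = 1 / 2 * |f'' ζ| := by field_simp
    _ ≤ 1 / 2 * (2 * β ^ 2 * Real.exp (-(β / 2 * s))) := by gcongr
    _ = β ^ 2 * Real.exp (-(β / 2 * s)) := by ring

/-- **BEYOND THE DIAGONAL (direct)**: `0 < s < u` ⟹ `|(β/4)sech²(βu/2)/(u − s) − ½(tanh(βu/2) − tanh(βs/2))/(u − s)²| ≤ 2e^{−βs}·(u − s)⁻¹²`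
(`(β/4)sech²(βu/2) ≤ βe^{−βu}` and `β(u−s)e^{−β(u−s)} ≤ 1`; `0 ≤ tanh(βu/2) − tanh(βs/2) ≤ 1 − tanh(βs/2) ≤ 2e^{−βs}`).
[cite: BenfattoGiulianiMastropietro2006, §2.1 (2.2)-(2.5)] -/
theorem abs_thermalDiagonal_deriv_far_le {β s u : ℝ} (hβ : 0 < β) (hs : 0 < s) (hsu : s < u) :
    |β / 4 * sech (β * u / 2) ^ 2 / (u - s) - 1 / 2 * (Real.tanh (β * u / 2) - Real.tanh (β * s / 2)) / (u - s) ^ 2| ≤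
      2 * Real.exp (-(β * s)) * ((u - s)⁻¹ ^ 2) := by
  have hd : 0 < u - s := sub_pos.2 hsu
  have hu0 : 0 < u := hs.trans hsu
  have hsech : sech (β * u / 2) ^ 2 ≤ 4 * Real.exp (-(β * u)) := by
    have h := sech_sq_le_four_exp_neg (β * u / 2)
    rwa [abs_of_nonneg (by positivity), show 2 * (β * u / 2) = β * u by ring] at h
  have h1 : |β / 4 * sech (β * u / 2) ^ 2 / (u - s)| ≤ Real.exp (-(β * s)) * ((u - s)⁻¹ ^ 2) := by
    rw [abs_of_nonneg (by positivity)]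
    have hx : β * (u - s) * Real.exp (-(β * (u - s))) ≤ 1 := by
      have e1 : β * (u - s) ≤ Real.exp (β * (u - s)) := by linarith [Real.add_one_le_exp (β * (u - s))]
      have e2 : Real.exp (-(β * (u - s))) * Real.exp (β * (u - s)) = 1 := by rw [← Real.exp_add]; simp
      nlinarith [Real.exp_pos (-(β * (u - s)))]
    have hsplit : Real.exp (-(β * u)) = Real.exp (-(β * (u - s))) * Real.exp (-(β * s)) := by rw [← Real.exp_add]; ring_nf
    calc β / 4 * sech (β * u / 2) ^ 2 / (u - s) ≤ β / 4 * (4 * Real.exp (-(β * u))) / (u - s) := by gcongr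
      _ = β * (u - s) * Real.exp (-(β * (u - s))) * (Real.exp (-(β * s)) * ((u - s)⁻¹ ^ 2)) := by
          rw [hsplit]; field_simp
      _ ≤ 1 * (Real.exp (-(β * s)) * ((u - s)⁻¹ ^ 2)) := by gcongr
      _ = Real.exp (-(β * s)) * ((u - s)⁻¹ ^ 2) := one_mul _
  have h2 : |1 / 2 * (Real.tanh (β * u / 2) - Real.tanh (β * s / 2)) / (u - s) ^ 2| ≤ Real.exp (-(β * s)) * ((u - s)⁻¹ ^ 2) := by
    have hmono : Real.tanh (β * s / 2) ≤ Real.tanh (β * u / 2) := by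
      have hx : Real.tanh (β * s / 2) ∈ Set.Ioo (-1 : ℝ) 1 := ⟨Real.neg_one_lt_tanh _, Real.tanh_lt_one _⟩
      have hy : Real.tanh (β * u / 2) ∈ Set.Ioo (-1 : ℝ) 1 := ⟨Real.neg_one_lt_tanh _, Real.tanh_lt_one _⟩
      exact (Real.artanh_le_artanh_iff hx hy).1 (by rw [Real.artanh_tanh, Real.artanh_tanh]; nlinarith)
    have hlt1 : Real.tanh (β * u / 2) < 1 := Real.tanh_lt_one _
    have hgap : 1 - Real.tanh (β * s / 2) ≤ 2 * Real.exp (-(β * s)) := by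
      have h := one_sub_tanh_le_two_exp_neg (β * s / 2)
      rwa [show 2 * (β * s / 2) = β * s by ring] at h
    rw [abs_of_nonneg (div_nonneg (mul_nonneg (by norm_num) (by linarith)) (by positivity))]
    calc 1 / 2 * (Real.tanh (β * u / 2) - Real.tanh (β * s / 2)) / (u - s) ^ 2 ≤ 1 / 2 * (2 * Real.exp (-(β * s))) / (u - s) ^ 2 := by
          gcongr; linarith
      _ = Real.exp (-(β * s)) * ((u - s)⁻¹ ^ 2) := by field_simp
  calc |β / 4 * sech (β * u / 2) ^ 2 / (u - s) - 1 / 2 * (Real.tanh (β * u / 2) - Real.tanh (β * s / 2)) / (u - s) ^ 2|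
      ≤ |β / 4 * sech (β * u / 2) ^ 2 / (u - s)| + |1 / 2 * (Real.tanh (β * u / 2) - Real.tanh (β * s / 2)) / (u - s) ^ 2| := abs_sub _ _
    _ ≤ Real.exp (-(β * s)) * ((u - s)⁻¹ ^ 2) + Real.exp (-(β * s)) * ((u - s)⁻¹ ^ 2) := add_le_add h1 h2
    _ = 2 * Real.exp (-(β * s)) * ((u - s)⁻¹ ^ 2) := by ring

end Summit.HubbardSuperconductivity.HubbardSuperconductivity.Theorems.C4a

end
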